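import Summits.Ventures.HodgeRepro2.T5SU11RadialGreenImproperStable

/-!
# The resolvent identity on the exponentially decaying class: `G^I_λ − G^I_{λ₂} = (μ − μ₂) G^I_λ G^I_{λ₂}`

For `λ, λ₂ > 1` and a source `g` of the exponentially decaying class at a rate `ε` with `ε > 2 − λ` and `ε > 2 − λ₂`
(rows 496–497, 499; `λ + λ₂ > 2` automatically):

* `G^I_{λ₂} g` is again in the class at every rate `ε′ < min(ε, λ₂)` (row 499), and `min(ε, λ₂) > 2 − λ`, so
  `G^I_λ(G^I_{λ₂} g)` is defined, solves `(L − μ)u = G^I_{λ₂} g`, is bounded at the origin and `o(φ_λ)` (rows 492–497);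
* `G^I_{λ₂} g/φ_λ → 0` (`tendsto_greenSolI_div_sph_atTop`: `|G^I_{λ₂} g| ≤ K e^{−ε′ t}` against
  `φ_λ ≥ (c/2) e^{(λ−2)t}`), so `w = G^I_λ g − G^I_{λ₂} g` is bounded at the origin, `o(φ_λ)`, and solves
  `(L − μ) w = (μ − μ₂) G^I_{λ₂} g` (`greenSolI_sub_ode`);

hence, by row 488's uniqueness, **`G^I_λ g − G^I_{λ₂} g = (μ − μ₂) · G^I_λ(G^I_{λ₂} g)` on `(0, ∞)`**
(`greenSolI_sub_greenSolI_eq`) — the resolvent identity of the radial Laplacian on the whole exponentially decaying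
class, with the composition given by the improper variation-of-parameters formula. Nothing is claimed about (N).

Blind lane: Mathlib + the HodgeRepro2 prefix only; no sorry; axioms ⊆ {propext, Classical.choice,
Quot.sound}.
-/

namespace Summit.Ventures.HodgeRepro2.T5SU11ResolventIdentityDecay

open Filter Topology MeasureTheory
open Set (Ioi Ioc)
open T5SU11Cartan T5SU11SphericalFunction T5SU11SphericalBounds T5SU11SphericalContinuous
  T5SU11SphericalSolutionSpaceAll T5SU11SphericalAsymptotic T5SU11SphericalCfun T5SU11SphericalDecay
  T5SU11RadialGreenImproper T5SU11RadialGreenImproperOrigin T5SU11RadialGreenImproperDecaySource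
  T5SU11RadialGreenImproperUnique T5SU11RadialGreenImproperStable T5SU11ResolventIdentity

section measure

variable [MeasurableSpace Circle] [BorelSpace Circle]

variable {lam lam₂ : ℝ} (hlam : 1 < lam) (hlam₂ : 1 < lam₂) {g : ℝ → ℝ} (hg : ContinuousOn g (Ioi 0))
  {M : ℝ} (hM : ∀ s ∈ Ioc (0 : ℝ) 1, |g s| ≤ M) (hM0 : 0 ≤ M)
  {ε C s₀ : ℝ} (hε : 2 - lam < ε) (hε₂ : 2 - lam₂ < ε) (hC : ∀ s, s₀ ≤ s → |g s| ≤ C * Real.exp (-ε * s))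

include hlam hlam₂ hg hM hM0 hε hε₂ hC in
/-- **`G^I_{λ₂} g / φ_λ → 0`** at infinity: `G^I_{λ₂} g = O(e^{−ε′ t})` with `ε′ > 2 − λ` against
`φ_λ ≥ (c/2) e^{(λ−2)t}`. -/
theorem tendsto_greenSolI_div_sph_atTop :
    Tendsto (fun t => greenSolI (fun t => sph lam₂ (hyp t)) (sphDecay lam₂) g t / sph lam (hyp t)) atTop (𝓝 0) := by
  -- a rate `ε′` with `2 − λ < ε′ < min(ε, λ₂)`
  set ε' := (2 - lam + min ε lam₂) / 2 with hε'
  have hmin : 2 - lam < min ε lam₂ := lt_min hε (by linarith)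
  have hε'1 : 2 - lam < ε' := by rw [hε']; linarith
  have hε'2 : ε' < min ε lam₂ := by rw [hε']; linarith
  obtain ⟨K, T, hK, hT, hKT⟩ := exists_abs_greenSolI_le_exp hlam₂ hg hM hM0 hε₂ hC hε'2
  have hc : 0 < cfun (2 - lam) := cfun_pos (by linarith)
  obtain ⟨T₁, hT₁⟩ := eventually_atTop.mp (eventually_le_sph_hyp hlam)
  have hlim : Tendsto (fun t => (2 * K / cfun (2 - lam)) * Real.exp (-(ε' + lam - 2) * t)) atTop (𝓝 0) := by
    have h := (Real.tendsto_exp_neg_atTop_nhds_zero.comp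
      (tendsto_id.const_mul_atTop (by linarith : 0 < ε' + lam - 2))).const_mul (2 * K / cfun (2 - lam))
    rw [mul_zero] at h
    refine h.congr' (Eventually.of_forall fun t => ?_)
    simp only [Function.comp_def, id]
    ring_nf
  refine squeeze_zero_norm' ?_ hlim
  filter_upwards [eventually_ge_atTop (max T T₁)] with t ht
  have hφ := hT₁ t (le_trans (le_max_right _ _) ht)
  have hφ0 : 0 < sph lam (hyp t) := sph_hyp_pos lam t
  have hG := hKT t (le_trans (le_max_left _ _) ht)
  rw [Real.norm_eq_abs, abs_div, abs_of_pos hφ0, div_le_iff₀ hφ0]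
  calc |greenSolI (fun t => sph lam₂ (hyp t)) (sphDecay lam₂) g t|
      ≤ K * Real.exp (-ε' * t) := hG
    _ = (2 * K / cfun (2 - lam)) * Real.exp (-(ε' + lam - 2) * t) * (cfun (2 - lam) / 2 * Real.exp ((lam - 2) * t)) := by
        rw [show Real.exp (-ε' * t) = Real.exp (-(ε' + lam - 2) * t) * Real.exp ((lam - 2) * t) by
          rw [← Real.exp_add]; congr 1; ring]
        field_simp
    _ ≤ (2 * K / cfun (2 - lam)) * Real.exp (-(ε' + lam - 2) * t) * sph lam (hyp t) :=
        mul_le_mul_of_nonneg_left hφ (by positivity)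

include hlam hlam₂ in
/-- **`(L − μ)(G^I_λ g − G^I_{λ₂} g) = (μ − μ₂) G^I_{λ₂} g`** on `(0, ∞)`. -/
theorem greenSolI_sub_ode {t : ℝ} (ht : 0 < t) :
    Real.sinh (2 * t) * (greenSolI'' (deriv (deriv fun t => sph lam (hyp t))) (sphDecay'' lam)
          (deriv fun t => sph lam (hyp t)) (sphDecay' lam) (fun t => sph lam (hyp t)) (sphDecay lam) g t
        - greenSolI'' (deriv (deriv fun t => sph lam₂ (hyp t))) (sphDecay'' lam₂)
          (deriv fun t => sph lam₂ (hyp t)) (sphDecay' lam₂) (fun t => sph lam₂ (hyp t)) (sphDecay lam₂) g t)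
      + 2 * Real.cosh (2 * t) * (greenSolI' (deriv fun t => sph lam (hyp t)) (sphDecay' lam)
          (fun t => sph lam (hyp t)) (sphDecay lam) g t
        - greenSolI' (deriv fun t => sph lam₂ (hyp t)) (sphDecay' lam₂) (fun t => sph lam₂ (hyp t))
          (sphDecay lam₂) g t)
      = lam * (lam - 2) * Real.sinh (2 * t) * (greenSolI (fun t => sph lam (hyp t)) (sphDecay lam) g t
          - greenSolI (fun t => sph lam₂ (hyp t)) (sphDecay lam₂) g t)
        + Real.sinh (2 * t) * ((lam * (lam - 2) - lam₂ * (lam₂ - 2))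
          * greenSolI (fun t => sph lam₂ (hyp t)) (sphDecay lam₂) g t) := by
  have e1 := greenSolI_ode (hode_sph lam) (fun _ hs => sphDecay_ode hlam hs) (fun _ hs => wronskian_sphDecay hlam hs)
    (g := g) ht
  have e2 := greenSolI_ode (hode_sph lam₂) (fun _ hs => sphDecay_ode hlam₂ hs)
    (fun _ hs => wronskian_sphDecay hlam₂ hs) (g := g) ht
  linear_combination e1 - e2

include hlam hlam₂ hg hM hM0 hε hε₂ hC in
/-- **THE RESOLVENT IDENTITY ON THE EXPONENTIALLY DECAYING CLASS**:
`G^I_λ g − G^I_{λ₂} g = (μ − μ₂) · G^I_λ(G^I_{λ₂} g)` on `(0, ∞)`. -/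
theorem greenSolI_sub_greenSolI_eq {t : ℝ} (ht : 0 < t) :
    greenSolI (fun t => sph lam (hyp t)) (sphDecay lam) g t
        - greenSolI (fun t => sph lam₂ (hyp t)) (sphDecay lam₂) g t
      = (lam * (lam - 2) - lam₂ * (lam₂ - 2))
        * greenSolI (fun t => sph lam (hyp t)) (sphDecay lam)
          (greenSolI (fun t => sph lam₂ (hyp t)) (sphDecay lam₂) g) t := by
  -- the source `g₂ = G^I_{λ₂} g` is in the class at a rate `ε′ > 2 − λ`
  set ε' := (2 - lam + min ε lam₂) / 2 with hε'
  have hmin : 2 - lam < min ε lam₂ := lt_min hε (by linarith)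
  have hε'1 : 2 - lam < ε' := by rw [hε']; linarith
  have hε'2 : ε' < min ε lam₂ := by rw [hε']; linarith
  have hg₂ := continuousOn_greenSolI hlam₂ hg hM hM0 hε₂ hC
  obtain ⟨M₂, hM₂0, hM₂⟩ := exists_abs_greenSolI_le_of_le_one hlam₂ hg hM hM0 hε₂ hC
  obtain ⟨K, T, hK, _, hKT⟩ := exists_abs_greenSolI_le_exp hlam₂ hg hM hM0 hε₂ hC hε'2
  have hC₂ : ∀ s, T ≤ s → |greenSolI (fun t => sph lam₂ (hyp t)) (sphDecay lam₂) g s| ≤ K * Real.exp (-ε' * s) :=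
    hKT
  set κ := lam * (lam - 2) - lam₂ * (lam₂ - 2) with hκ
  -- data of `G^I_λ g`, `G^I_{λ₂} g` and `G^I_λ(g₂)`
  have hB₁ := integrableOn_sph_mul_mul_sinh_Ioc hg hM hM0 lam
  have hA₁ := integrableOn_sphDecay_mul_mul_sinh hlam hg hM hM0 hε hC
  have hB₂ := integrableOn_sph_mul_mul_sinh_Ioc hg hM hM0 lam₂
  have hA₂ := integrableOn_sphDecay_mul_mul_sinh hlam₂ hg hM hM0 hε₂ hC
  have hB₃ := integrableOn_sph_mul_mul_sinh_Ioc hg₂ hM₂ hM₂0 lam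
  have hA₃ := integrableOn_sphDecay_mul_mul_sinh hlam hg₂ hM₂ hM₂0 hε'1 hC₂
  -- `w = G^I_λ g − G^I_{λ₂} g`
  have hw : ∀ s, 0 < s → HasDerivAt (fun s => greenSolI (fun t => sph lam (hyp t)) (sphDecay lam) g s
      - greenSolI (fun t => sph lam₂ (hyp t)) (sphDecay lam₂) g s)
      (greenSolI' (deriv fun t => sph lam (hyp t)) (sphDecay' lam) (fun t => sph lam (hyp t)) (sphDecay lam) g s
        - greenSolI' (deriv fun t => sph lam₂ (hyp t)) (sphDecay' lam₂) (fun t => sph lam₂ (hyp t))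
          (sphDecay lam₂) g s) s :=
    fun s hs => (hasDerivAt_greenSolI (hφ_sph lam) (fun _ hs => hasDerivAt_sphDecay hlam hs) hg hB₁ hA₁ hs).sub
      (hasDerivAt_greenSolI (hφ_sph lam₂) (fun _ hs => hasDerivAt_sphDecay hlam₂ hs) hg hB₂ hA₂ hs)
  have hw' : ∀ s, 0 < s → HasDerivAt (fun s => greenSolI' (deriv fun t => sph lam (hyp t)) (sphDecay' lam)
      (fun t => sph lam (hyp t)) (sphDecay lam) g s
      - greenSolI' (deriv fun t => sph lam₂ (hyp t)) (sphDecay' lam₂) (fun t => sph lam₂ (hyp t)) (sphDecay lam₂) g s)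
      (greenSolI'' (deriv (deriv fun t => sph lam (hyp t))) (sphDecay'' lam) (deriv fun t => sph lam (hyp t))
          (sphDecay' lam) (fun t => sph lam (hyp t)) (sphDecay lam) g s
        - greenSolI'' (deriv (deriv fun t => sph lam₂ (hyp t))) (sphDecay'' lam₂) (deriv fun t => sph lam₂ (hyp t))
          (sphDecay' lam₂) (fun t => sph lam₂ (hyp t)) (sphDecay lam₂) g s) s :=
    fun s hs => (hasDerivAt_greenSolI' (hφ_sph lam) (hφ'_sph lam) (fun _ hs => hasDerivAt_sphDecay hlam hs)
        (fun _ hs => hasDerivAt_sphDecay' lam hs) hg hB₁ hA₁ hs).sub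
      (hasDerivAt_greenSolI' (hφ_sph lam₂) (hφ'_sph lam₂) (fun _ hs => hasDerivAt_sphDecay hlam₂ hs)
        (fun _ hs => hasDerivAt_sphDecay' lam₂ hs) hg hB₂ hA₂ hs)
  obtain ⟨B₁, hB₁d⟩ := eventually_abs_greenSolI_le hlam hM hM0 hA₁
  obtain ⟨B₂, hB₂d⟩ := eventually_abs_greenSolI_le hlam₂ hM hM0 hA₂
  have hwB : ∀ᶠ s in 𝓝[>] (0 : ℝ), |greenSolI (fun t => sph lam (hyp t)) (sphDecay lam) g s
      - greenSolI (fun t => sph lam₂ (hyp t)) (sphDecay lam₂) g s| ≤ B₁ + B₂ := by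
    filter_upwards [hB₁d, hB₂d] with s h1 h2
    exact le_trans (abs_sub _ _) (add_le_add h1 h2)
  have hwd : Tendsto (fun s => (greenSolI (fun t => sph lam (hyp t)) (sphDecay lam) g s
      - greenSolI (fun t => sph lam₂ (hyp t)) (sphDecay lam₂) g s) / sph lam (hyp s)) atTop (𝓝 0) := by
    have h := (tendsto_greenSolI_div_atTop hlam hg hM hM0 hε hC).sub
      (tendsto_greenSolI_div_sph_atTop hlam hlam₂ hg hM hM0 hε hε₂ hC)
    rw [sub_zero] at h
    refine h.congr' (Eventually.of_forall fun s => ?_)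
    show _ = (greenSolI (fun t => sph lam (hyp t)) (sphDecay lam) g s
      - greenSolI (fun t => sph lam₂ (hyp t)) (sphDecay lam₂) g s) / sph lam (hyp s)
    rw [sub_div]
  -- `v = κ G^I_λ(g₂)`
  have hv : ∀ s, 0 < s → HasDerivAt (fun s => κ * greenSolI (fun t => sph lam (hyp t)) (sphDecay lam)
      (greenSolI (fun t => sph lam₂ (hyp t)) (sphDecay lam₂) g) s)
      (κ * greenSolI' (deriv fun t => sph lam (hyp t)) (sphDecay' lam) (fun t => sph lam (hyp t)) (sphDecay lam)
        (greenSolI (fun t => sph lam₂ (hyp t)) (sphDecay lam₂) g) s) s :=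
    fun s hs => (hasDerivAt_greenSolI (hφ_sph lam) (fun _ hs => hasDerivAt_sphDecay hlam hs) hg₂ hB₃ hA₃ hs).const_mul κ
  have hv' : ∀ s, 0 < s → HasDerivAt (fun s => κ * greenSolI' (deriv fun t => sph lam (hyp t)) (sphDecay' lam)
      (fun t => sph lam (hyp t)) (sphDecay lam) (greenSolI (fun t => sph lam₂ (hyp t)) (sphDecay lam₂) g) s)
      (κ * greenSolI'' (deriv (deriv fun t => sph lam (hyp t))) (sphDecay'' lam) (deriv fun t => sph lam (hyp t))
        (sphDecay' lam) (fun t => sph lam (hyp t)) (sphDecay lam)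
        (greenSolI (fun t => sph lam₂ (hyp t)) (sphDecay lam₂) g) s) s :=
    fun s hs => (hasDerivAt_greenSolI' (hφ_sph lam) (hφ'_sph lam) (fun _ hs => hasDerivAt_sphDecay hlam hs)
      (fun _ hs => hasDerivAt_sphDecay' lam hs) hg₂ hB₃ hA₃ hs).const_mul κ
  have hvode : ∀ s, 0 < s → Real.sinh (2 * s) * (κ * greenSolI'' (deriv (deriv fun t => sph lam (hyp t)))
        (sphDecay'' lam) (deriv fun t => sph lam (hyp t)) (sphDecay' lam) (fun t => sph lam (hyp t)) (sphDecay lam)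
        (greenSolI (fun t => sph lam₂ (hyp t)) (sphDecay lam₂) g) s)
      + 2 * Real.cosh (2 * s) * (κ * greenSolI' (deriv fun t => sph lam (hyp t)) (sphDecay' lam)
        (fun t => sph lam (hyp t)) (sphDecay lam) (greenSolI (fun t => sph lam₂ (hyp t)) (sphDecay lam₂) g) s)
      = lam * (lam - 2) * Real.sinh (2 * s) * (κ * greenSolI (fun t => sph lam (hyp t)) (sphDecay lam)
          (greenSolI (fun t => sph lam₂ (hyp t)) (sphDecay lam₂) g) s)
        + Real.sinh (2 * s) * (κ * greenSolI (fun t => sph lam₂ (hyp t)) (sphDecay lam₂) g s) := by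
    intro s hs
    have e := greenSolI_ode (hode_sph lam) (fun _ hs => sphDecay_ode hlam hs) (fun _ hs => wronskian_sphDecay hlam hs)
      (g := greenSolI (fun t => sph lam₂ (hyp t)) (sphDecay lam₂) g) hs
    linear_combination κ * e
  obtain ⟨B₃, hB₃d⟩ := eventually_abs_greenSolI_le hlam hM₂ hM₂0 hA₃
  have hvB : ∀ᶠ s in 𝓝[>] (0 : ℝ), |κ * greenSolI (fun t => sph lam (hyp t)) (sphDecay lam)
      (greenSolI (fun t => sph lam₂ (hyp t)) (sphDecay lam₂) g) s| ≤ |κ| * B₃ := by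
    filter_upwards [hB₃d] with s hs
    rw [abs_mul]
    exact mul_le_mul_of_nonneg_left hs (abs_nonneg _)
  have hvd : Tendsto (fun s => κ * greenSolI (fun t => sph lam (hyp t)) (sphDecay lam)
      (greenSolI (fun t => sph lam₂ (hyp t)) (sphDecay lam₂) g) s / sph lam (hyp s)) atTop (𝓝 0) := by
    have := (tendsto_greenSolI_div_atTop hlam hg₂ hM₂ hM₂0 hε'1 hC₂).const_mul κ
    rw [mul_zero] at this
    refine this.congr' (Eventually.of_forall fun s => ?_)
    ring
  -- uniqueness (row 488) for the common source `κ g₂`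
  have := eq_of_ode_of_bounded_of_decay lam (g := fun s => κ * greenSolI (fun t => sph lam₂ (hyp t)) (sphDecay lam₂) g s)
    hv hv' hvode hw hw' (fun _ hs => greenSolI_sub_ode hlam hlam₂ (g := g) hs) hvB hwB hvd hwd ht
  exact this.symm

end measure

end Summit.Ventures.HodgeRepro2.T5SU11ResolventIdentityDecay
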